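import Literature.AlgebraicGeometry.HodgeTheory.AbelianVarietySubvarietyIsotypicSystem
import HarnessLib

/-!
# The isotypic pieces are ADDITIVE along a decomposition: if `Z ⊞ Z' → X` (or `⨁_l Z_l → X`) is an isogeny of abelian
# subvarieties, then `Z_q ⊞ Z'_q → Y_q` (resp. `⨁_l (Z_l)_q → Y_q`) is an isogeny for every isotypic component `Y_q`;
# dimensions and multiplicities add (Mumford §19 Thm. 1, Cor. 1–2; Milne §12 Prop. 12.1; Lange–Rodríguez §2.9)

Layer `Literature/AlgebraicGeometry/HodgeTheory`; theorems only (no `def`, no instance, no named fact; net debt 0).  §§1–2 hold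
over ANY field in the setting of `HodgeTheory/AbelianVarietySubvarietyIsotypicPieces` §1 (a `Hom`-orthogonal system of
abelian subvarieties `i_q : Y_q ↪ X` whose addition map is an isogeny with quasi-inverse `v`, `desc i ≫ v = m • 𝟙`,
`m ≠ 0`, central projectors `u_q = (v ≫ π_q) ≫ i_q`; abelian subvarieties `j : Z ↪ X`, `j' : Z' ↪ X` (§1) or
`j_l : Z_l ↪ X` (§2) with their pieces `a_q : Z_q = im(j ≫ u_q) ↪ Z`, `b_q : Z_q ↪ Y_q` given as data); §3 works over a
PERFECT field, where the pieces exist (`exists_isotypicPieces`, quasi-retractions) and complements exist (Poincaré).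

THE PRINT.  Mumford, *Abelian Varieties* §19 Thm. 1 (p. 173: for an abelian subvariety `Y ⊂ X` there is `Z ⊂ X` with
`Y ∩ Z` finite and `Y + Z = X`, i.e. `Y × Z → X` an isogeny), Cor. 1 (p. 173: `X ∼ ∏ X_i^{n_i}`, the `n_i` and the `X_i`
unique up to isogeny and permutation) and Cor. 2 (p. 174); Milne 1986 §12 Prop. 12.1 and p. 122 (PDF p. 189: «the `r_i`
are uniquely determined»); Lange–Rodríguez 2022 §2.9 Thm. 2.9.1 (PDF p. 43: the isotypical components `A^{e_i} =
Im(m e_i)` of the central idempotents; (b) the addition map is an isogeny) and p. 44.  ADDITIVITY is the standard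
consequence of the uniqueness of the exponents: if `X ∼ Z × Z'` then the multiplicity of every simple type in `X` is the
sum of its multiplicities in `Z` and `Z'`.  The statements below prove the finer, choice-free form over any field: the
central projector `u_q` maps `Z` onto `Z_q`, `Z'` onto `Z'_q` and `X = Z + Z'` onto `Y_q`, so `Z_q + Z'_q = Y_q`; and
`Z_q ⊞ Z'_q → Y_q → X` equals `(a_q ⊞ a'_q) ≫ (Z ⊞ Z' → X)`, which is finite.

Results (namespace `Literature.AlgebraicGeometry.HodgeTheory.AbelianVariety`):
* §1 (any field, a pair) `biprod_map_toImage_comp_biprod_desc_isotypicPieces_comp`, `biprod_desc_isotypicPieces_comp_component`,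
  **`surjective_biprod_desc_isotypicPieces`** (`Z + Z' = X ⟹ Z_q + Z'_q = Y_q`), **`isIsogeny_biprod_desc_isotypicPieces`**
  (`Z ⊞ Z' → X` an isogeny ⟹ `Z_q ⊞ Z'_q → Y_q` an isogeny), **`dim_component_eq_dim_isotypicPiece_add`** (`dim Y_q = dim Z_q
  + dim Z'_q`), `isIsogenous_biprod_isotypicPieces_component`, **`multiplicity_eq_add_of_isIsogeny_biprod_desc`** (`Y_q ∼ B^t`,
  `Z_q ∼ B^s`, `Z'_q ∼ B^{s'}`, `0 < dim B` ⟹ `t = s + s'`);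
* §2 (any field, a finite family `j_l : Z_l ↪ X` with `⨁_l Z_l → X` an isogeny) `biproduct_map_toImage_comp_biproduct_desc_isotypicPieces_comp`,
  `biproduct_desc_isotypicPieces_comp_component`, **`surjective_biproduct_desc_isotypicPieces_of_family`**,
  **`isIsogeny_biproduct_desc_isotypicPieces_of_family`**, **`dim_component_eq_sum_dim_isotypicPieces`**,
  `multiplicity_eq_sum_of_isIsogeny_biproduct_desc`;
* §3 (perfect field) **`dim_component_eq_dim_isotypicPiece_add_of_perfectField`** (pieces-data-free),
  `dim_component_eq_sum_dim_isotypicPieces_of_perfectField`, **`multiplicity_isotypicComponents_eq_add`** (for isotypic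
  components `Y_q ∼ B_q^{n_q+1}`: `n_q + 1 = s_q + s'_q`), **`exists_complement_dim_component_eq_add`** (every abelian
  subvariety has a Poincaré complement, and the pieces of the two add up to the components).

## References
* [MumfordAV1970] D. Mumford, *Abelian Varieties* (1970), §19 Thm. 1, Remark p. 169, Cor. 1–2 (pp. 169–174).
* [Milne1986AbelianVarieties] J. S. Milne, *Abelian Varieties*, in Cornell–Silverman, *Arithmetic Geometry* (1986), §12
  Prop. 12.1 and p. 122 (PDF p. 189).
* [LangeRodriguez2022] H. Lange, R. E. Rodríguez, *Decomposition of Jacobians by Prym Varieties*, LNM 2310 (2022), §2.9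
  Thm. 2.9.1 and the paragraph following it (PDF pp. 43–44).
* [SilverbergZarhin2015] A. Silverberg, Yu. G. Zarhin, *Isogenies of abelian varieties over finite fields*, Des. Codes
  Cryptogr. 77 (2015) (arXiv:1409.0592), Def. 2.2–2.3 (p. 3), Def. 3.2 and proof of Lemma 3.3 (p. 5).
* [GortzWedhorn2020] U. Görtz, T. Wedhorn, *Algebraic Geometry I: Schemes*, 2nd ed. (2020), Remark 10.32, Prop. 12.11.
-/

noncomputable section

universe u

open CategoryTheory CategoryTheory.Limits

namespace Literature.AlgebraicGeometry.HodgeTheory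

namespace AbelianVariety

open _root_.AlgebraicGeometry
open Literature.AlgebraicGeometry.Motives Literature.AlgebraicGeometry.Motives.AbelianVariety

variable {K : Type u} [Field K]

/-! ## §1 A pair of abelian subvarieties with `Z ⊞ Z' → X` an isogeny (any field) -/

section Pair

variable {Q : Type} [Fintype Q] {X Z Z' : Motives.AbelianVariety K} {Y : Q → Motives.AbelianVariety K}
  (i : ∀ q, Y q ⟶ X) {v : X ⟶ ⨁ Y} {m : ℕ} (j : Z ⟶ X) (j' : Z' ⟶ X)

/-- `(Z ⊞ Z' ↠ Z_q ⊞ Z'_q) ≫ (b_q, b'_q) ≫ i_q = (j, j') ≫ u_q`: the projector `u_q` restricted along the decomposition.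
[cite: LangeRodriguez2022, §2.9 Thm. 2.9.1 (PDF p. 43: `A^{e_i} = Im(m e_i)`)] [cite: MumfordAV1970, §19 Thm. 1 (p. 173)] -/
theorem biprod_map_toImage_comp_biprod_desc_isotypicPieces_comp
    (b : ∀ q, image (j ≫ (v ≫ biproduct.π Y q) ≫ i q) ⟶ Y q)
    (hb : ∀ q, b q ≫ i q = imageι (j ≫ (v ≫ biproduct.π Y q) ≫ i q))
    (b' : ∀ q, image (j' ≫ (v ≫ biproduct.π Y q) ≫ i q) ⟶ Y q)
    (hb' : ∀ q, b' q ≫ i q = imageι (j' ≫ (v ≫ biproduct.π Y q) ≫ i q)) (q : Q) :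
    biprod.map (toImage (j ≫ (v ≫ biproduct.π Y q) ≫ i q)) (toImage (j' ≫ (v ≫ biproduct.π Y q) ≫ i q)) ≫
        biprod.desc (b q) (b' q) ≫ i q = biprod.desc j j' ≫ (v ≫ biproduct.π Y q) ≫ i q :=
  biprod.hom_ext' _ _
    (by rw [biprod.inl_map_assoc, biprod.inl_desc_assoc, hb, toImage_imageι, biprod.inl_desc_assoc])
    (by rw [biprod.inr_map_assoc, biprod.inr_desc_assoc, hb', toImage_imageι, biprod.inr_desc_assoc])

/-- `(b_q, b'_q) ≫ i_q = (a_q ⊞ a'_q) ≫ (j, j')`: the addition map of the pieces followed by `Y_q ↪ X` factors through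
the addition map `Z ⊞ Z' → X`. [cite: MumfordAV1970, §19 Thm. 1 (p. 173)] [cite: LangeRodriguez2022, §2.9 Thm. 2.9.1 (PDF p. 43)] -/
theorem biprod_desc_isotypicPieces_comp_component (a : ∀ q, image (j ≫ (v ≫ biproduct.π Y q) ≫ i q) ⟶ Z)
    (ha : ∀ q, a q ≫ j = imageι (j ≫ (v ≫ biproduct.π Y q) ≫ i q))
    (a' : ∀ q, image (j' ≫ (v ≫ biproduct.π Y q) ≫ i q) ⟶ Z')
    (ha' : ∀ q, a' q ≫ j' = imageι (j' ≫ (v ≫ biproduct.π Y q) ≫ i q))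
    (b : ∀ q, image (j ≫ (v ≫ biproduct.π Y q) ≫ i q) ⟶ Y q)
    (hb : ∀ q, b q ≫ i q = imageι (j ≫ (v ≫ biproduct.π Y q) ≫ i q))
    (b' : ∀ q, image (j' ≫ (v ≫ biproduct.π Y q) ≫ i q) ⟶ Y q)
    (hb' : ∀ q, b' q ≫ i q = imageι (j' ≫ (v ≫ biproduct.π Y q) ≫ i q)) (q : Q) :
    biprod.desc (b q) (b' q) ≫ i q = biprod.map (a q) (a' q) ≫ biprod.desc j j' :=
  biprod.hom_ext' _ _ (by rw [biprod.inl_desc_assoc, hb, biprod.inl_map_assoc, biprod.inl_desc, ha])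
    (by rw [biprod.inr_desc_assoc, hb', biprod.inr_map_assoc, biprod.inr_desc, ha'])

/-- **`Z + Z' = X ⟹ Z_q + Z'_q = Y_q`**: if the addition map `Z ⊞ Z' → X` is surjective, so is the addition map
`Z_q ⊞ Z'_q → Y_q` of the `q`-th pieces (`u_q(Z + Z') = u_q(X) = Y_q`, `m ≠ 0`). [cite: MumfordAV1970, §19 Thm. 1 (p. 173) and Cor. 2 (p. 174)]
[cite: LangeRodriguez2022, §2.9 Thm. 2.9.1 (PDF p. 43)] [cite: GortzWedhorn2020, Remark 10.32 (PDF p. 312)] -/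
theorem surjective_biprod_desc_isotypicPieces (hi : ∀ q, IsClosedImmersion (Hom.toSchemeHom (i q)))
    (hdv : biproduct.desc i ≫ v = m • 𝟙 (⨁ Y)) (hm : m ≠ 0) [Surjective (Hom.toSchemeHom (biprod.desc j j'))]
    (b : ∀ q, image (j ≫ (v ≫ biproduct.π Y q) ≫ i q) ⟶ Y q)
    (hb : ∀ q, b q ≫ i q = imageι (j ≫ (v ≫ biproduct.π Y q) ≫ i q))
    (b' : ∀ q, image (j' ≫ (v ≫ biproduct.π Y q) ≫ i q) ⟶ Y q)
    (hb' : ∀ q, b' q ≫ i q = imageι (j' ≫ (v ≫ biproduct.π Y q) ≫ i q)) (q : Q) :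
    Surjective (Hom.toSchemeHom (biprod.desc (b q) (b' q))) := by
  haveI := hi q
  haveI : Surjective (Hom.toSchemeHom
      (biprod.map (toImage (j ≫ (v ≫ biproduct.π Y q) ≫ i q)) (toImage (j' ≫ (v ≫ biproduct.π Y q) ≫ i q)) ≫
        biprod.desc (b q) (b' q))) :=
    surjective_of_range_comp_eq _ (i q) (by
      rw [Category.assoc (biprod.map _ _) (biprod.desc (b q) (b' q)) (i q),
        biprod_map_toImage_comp_biprod_desc_isotypicPieces_comp i j j' b hb b' hb' q,
        range_toSchemeHom_comp_eq_of_surjective (biprod.desc j j') _, range_isotypicProjector i hdv hm q])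
  exact surjective_of_surjective_comp
    (biprod.map (toImage (j ≫ (v ≫ biproduct.π Y q) ≫ i q)) (toImage (j' ≫ (v ≫ biproduct.π Y q) ≫ i q))) _

/-- **ADDITIVITY OF THE PIECES: `Z ⊞ Z' → X` an isogeny ⟹ `Z_q ⊞ Z'_q → Y_q` an isogeny** for every `q` (any field) —
surjective by `Z_q + Z'_q = Y_q`, finite because followed by `i_q` it is `(a_q ⊞ a'_q) ≫ (Z ⊞ Z' → X)`.
[cite: MumfordAV1970, §19 Thm. 1 and Cor. 1–2 (pp. 173–174)] [cite: Milne1986AbelianVarieties, §12 Prop. 12.1 and p. 122 (PDF p. 189)]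
[cite: LangeRodriguez2022, §2.9 Thm. 2.9.1 (PDF p. 43)] -/
theorem isIsogeny_biprod_desc_isotypicPieces (hi : ∀ q, IsClosedImmersion (Hom.toSchemeHom (i q)))
    (hdv : biproduct.desc i ≫ v = m • 𝟙 (⨁ Y)) (hm : m ≠ 0) [IsClosedImmersion (Hom.toSchemeHom j)]
    [IsClosedImmersion (Hom.toSchemeHom j')] (hjj' : IsIsogeny (biprod.desc j j'))
    (a : ∀ q, image (j ≫ (v ≫ biproduct.π Y q) ≫ i q) ⟶ Z) (ha : ∀ q, a q ≫ j = imageι (j ≫ (v ≫ biproduct.π Y q) ≫ i q))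
    (a' : ∀ q, image (j' ≫ (v ≫ biproduct.π Y q) ≫ i q) ⟶ Z')
    (ha' : ∀ q, a' q ≫ j' = imageι (j' ≫ (v ≫ biproduct.π Y q) ≫ i q))
    (b : ∀ q, image (j ≫ (v ≫ biproduct.π Y q) ≫ i q) ⟶ Y q)
    (hb : ∀ q, b q ≫ i q = imageι (j ≫ (v ≫ biproduct.π Y q) ≫ i q))
    (b' : ∀ q, image (j' ≫ (v ≫ biproduct.π Y q) ≫ i q) ⟶ Y q)
    (hb' : ∀ q, b' q ≫ i q = imageι (j' ≫ (v ≫ biproduct.π Y q) ≫ i q)) (q : Q) :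
    IsIsogeny (biprod.desc (b q) (b' q)) := by
  haveI := hjj'.1
  refine ⟨surjective_biprod_desc_isotypicPieces i j j' hi hdv hm b hb b' hb' q, ?_⟩
  haveI := isClosedImmersion_of_comp_eq_of_isClosedImmersion _ j (a q) (ha q)
  haveI := isClosedImmersion_of_comp_eq_of_isClosedImmersion _ j' (a' q) (ha' q)
  haveI := isFinite_toSchemeHom_biprod_map (a q) (a' q)
  haveI : IsFinite (Hom.toSchemeHom (biprod.desc j j')) := hjj'.2
  haveI : IsFinite (Hom.toSchemeHom (biprod.map (a q) (a' q) ≫ biprod.desc j j')) := isFinite_toSchemeHom_comp _ _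
  haveI : IsFinite (Hom.toSchemeHom (biprod.desc (b q) (b' q) ≫ i q)) := by
    rw [biprod_desc_isotypicPieces_comp_component i j j' a ha a' ha' b hb b' hb' q]
    infer_instance
  exact isFinite_of_isFinite_comp _ (i q)

/-- **`dim Y_q = dim Z_q + dim Z'_q`** when `Z ⊞ Z' → X` is an isogeny (any field).
[cite: MumfordAV1970, §19 Cor. 1 of Thm. 1 (p. 173)] [cite: Milne1986AbelianVarieties, §12 Prop. 12.1 and p. 122 (PDF p. 189)] -/
theorem dim_component_eq_dim_isotypicPiece_add (hi : ∀ q, IsClosedImmersion (Hom.toSchemeHom (i q)))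
    (hdv : biproduct.desc i ≫ v = m • 𝟙 (⨁ Y)) (hm : m ≠ 0) [IsClosedImmersion (Hom.toSchemeHom j)]
    [IsClosedImmersion (Hom.toSchemeHom j')] (hjj' : IsIsogeny (biprod.desc j j'))
    (a : ∀ q, image (j ≫ (v ≫ biproduct.π Y q) ≫ i q) ⟶ Z) (ha : ∀ q, a q ≫ j = imageι (j ≫ (v ≫ biproduct.π Y q) ≫ i q))
    (a' : ∀ q, image (j' ≫ (v ≫ biproduct.π Y q) ≫ i q) ⟶ Z')
    (ha' : ∀ q, a' q ≫ j' = imageι (j' ≫ (v ≫ biproduct.π Y q) ≫ i q))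
    (b : ∀ q, image (j ≫ (v ≫ biproduct.π Y q) ≫ i q) ⟶ Y q)
    (hb : ∀ q, b q ≫ i q = imageι (j ≫ (v ≫ biproduct.π Y q) ≫ i q))
    (b' : ∀ q, image (j' ≫ (v ≫ biproduct.π Y q) ≫ i q) ⟶ Y q)
    (hb' : ∀ q, b' q ≫ i q = imageι (j' ≫ (v ≫ biproduct.π Y q) ≫ i q)) (q : Q) :
    (Y q).dim = (image (j ≫ (v ≫ biproduct.π Y q) ≫ i q)).dim + (image (j' ≫ (v ≫ biproduct.π Y q) ≫ i q)).dim := by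
  rw [← dim_eq_of_isIsogeny (isIsogeny_biprod_desc_isotypicPieces i j j' hi hdv hm hjj' a ha a' ha' b hb b' hb' q),
    dim_biprod]

/-- `Z_q ⊞ Z'_q ∼ Y_q` when `Z ⊞ Z' → X` is an isogeny (any field). [cite: MumfordAV1970, §19 Thm. 1 and Cor. 1 (p. 173)] -/
theorem isIsogenous_biprod_isotypicPieces_component (hi : ∀ q, IsClosedImmersion (Hom.toSchemeHom (i q)))
    (hdv : biproduct.desc i ≫ v = m • 𝟙 (⨁ Y)) (hm : m ≠ 0) [IsClosedImmersion (Hom.toSchemeHom j)]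
    [IsClosedImmersion (Hom.toSchemeHom j')] (hjj' : IsIsogeny (biprod.desc j j'))
    (a : ∀ q, image (j ≫ (v ≫ biproduct.π Y q) ≫ i q) ⟶ Z) (ha : ∀ q, a q ≫ j = imageι (j ≫ (v ≫ biproduct.π Y q) ≫ i q))
    (a' : ∀ q, image (j' ≫ (v ≫ biproduct.π Y q) ≫ i q) ⟶ Z')
    (ha' : ∀ q, a' q ≫ j' = imageι (j' ≫ (v ≫ biproduct.π Y q) ≫ i q))
    (b : ∀ q, image (j ≫ (v ≫ biproduct.π Y q) ≫ i q) ⟶ Y q)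
    (hb : ∀ q, b q ≫ i q = imageι (j ≫ (v ≫ biproduct.π Y q) ≫ i q))
    (b' : ∀ q, image (j' ≫ (v ≫ biproduct.π Y q) ≫ i q) ⟶ Y q)
    (hb' : ∀ q, b' q ≫ i q = imageι (j' ≫ (v ≫ biproduct.π Y q) ≫ i q)) (q : Q) :
    IsIsogenous (image (j ≫ (v ≫ biproduct.π Y q) ≫ i q) ⊞ image (j' ≫ (v ≫ biproduct.π Y q) ≫ i q)) (Y q) :=
  ⟨_, isIsogeny_biprod_desc_isotypicPieces i j j' hi hdv hm hjj' a ha a' ha' b hb b' hb' q⟩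

/-- **MULTIPLICITIES ADD** (any field): if `Y_q ∼ B^t`, `Z_q ∼ B^s`, `Z'_q ∼ B^{s'}` with `0 < dim B` and `Z ⊞ Z' → X`
is an isogeny, then `t = s + s'`. [cite: MumfordAV1970, §19 Cor. 1 of Thm. 1 (p. 173: the `n_i` are uniquely determined)]
[cite: Milne1986AbelianVarieties, §12 Prop. 12.1 and p. 122 (PDF p. 189: «the r_i are uniquely determined»)] -/
theorem multiplicity_eq_add_of_isIsogeny_biprod_desc (hi : ∀ q, IsClosedImmersion (Hom.toSchemeHom (i q)))
    (hdv : biproduct.desc i ≫ v = m • 𝟙 (⨁ Y)) (hm : m ≠ 0) [IsClosedImmersion (Hom.toSchemeHom j)]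
    [IsClosedImmersion (Hom.toSchemeHom j')] (hjj' : IsIsogeny (biprod.desc j j'))
    (a : ∀ q, image (j ≫ (v ≫ biproduct.π Y q) ≫ i q) ⟶ Z) (ha : ∀ q, a q ≫ j = imageι (j ≫ (v ≫ biproduct.π Y q) ≫ i q))
    (a' : ∀ q, image (j' ≫ (v ≫ biproduct.π Y q) ≫ i q) ⟶ Z')
    (ha' : ∀ q, a' q ≫ j' = imageι (j' ≫ (v ≫ biproduct.π Y q) ≫ i q))
    (b : ∀ q, image (j ≫ (v ≫ biproduct.π Y q) ≫ i q) ⟶ Y q)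
    (hb : ∀ q, b q ≫ i q = imageι (j ≫ (v ≫ biproduct.π Y q) ≫ i q))
    (b' : ∀ q, image (j' ≫ (v ≫ biproduct.π Y q) ≫ i q) ⟶ Y q)
    (hb' : ∀ q, b' q ≫ i q = imageι (j' ≫ (v ≫ biproduct.π Y q) ≫ i q)) (q : Q) {B : Motives.AbelianVariety K}
    (hB0 : 0 < B.dim) {t s s' : ℕ} (ht : IsIsogenous (Y q) (⨁ fun _ : Fin t ↦ B))
    (hs : IsIsogenous (image (j ≫ (v ≫ biproduct.π Y q) ≫ i q)) (⨁ fun _ : Fin s ↦ B))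
    (hs' : IsIsogenous (image (j' ≫ (v ≫ biproduct.π Y q) ≫ i q)) (⨁ fun _ : Fin s' ↦ B)) : t = s + s' := by
  have hd := dim_component_eq_dim_isotypicPiece_add i j j' hi hdv hm hjj' a ha a' ha' b hb b' hb' q
  rw [dim_eq_mul_of_isIsogenous_biproduct_const ht, dim_eq_mul_of_isIsogenous_biproduct_const hs,
    dim_eq_mul_of_isIsogenous_biproduct_const hs', ← add_mul] at hd
  exact Nat.eq_of_mul_eq_mul_right hB0 hd

end Pair

/-! ## §2 A finite family of abelian subvarieties with `⨁_l Z_l → X` an isogeny (any field) -/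

section Family

variable {Q : Type} [Fintype Q] {X : Motives.AbelianVariety K} {Y : Q → Motives.AbelianVariety K} (i : ∀ q, Y q ⟶ X)
  {v : X ⟶ ⨁ Y} {m : ℕ} {L : Type} [Fintype L] {Zf : L → Motives.AbelianVariety K} (jf : ∀ l, Zf l ⟶ X)

/-- `(⨁_l Z_l ↠ ⨁_l (Z_l)_q) ≫ desc b_{l,q} ≫ i_q = desc j_l ≫ u_q`. [cite: LangeRodriguez2022, §2.9 Thm. 2.9.1 (PDF p. 43)]
[cite: MumfordAV1970, §19 Thm. 1 (p. 173)] -/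
theorem biproduct_map_toImage_comp_biproduct_desc_isotypicPieces_comp
    (b : ∀ l q, image (jf l ≫ (v ≫ biproduct.π Y q) ≫ i q) ⟶ Y q)
    (hb : ∀ l q, b l q ≫ i q = imageι (jf l ≫ (v ≫ biproduct.π Y q) ≫ i q)) (q : Q) :
    biproduct.map (fun l ↦ toImage (jf l ≫ (v ≫ biproduct.π Y q) ≫ i q)) ≫ biproduct.desc (fun l ↦ b l q) ≫ i q =
      biproduct.desc jf ≫ (v ≫ biproduct.π Y q) ≫ i q := by
  classical
  exact biproduct.hom_ext' _ _ fun l ↦ by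
    rw [biproduct.ι_map_assoc, biproduct.ι_desc_assoc, hb, toImage_imageι, biproduct.ι_desc_assoc]

/-- `desc b_{l,q} ≫ i_q = (⨁_l a_{l,q}) ≫ desc j_l`. [cite: MumfordAV1970, §19 Thm. 1 (p. 173)]
[cite: LangeRodriguez2022, §2.9 Thm. 2.9.1 (PDF p. 43)] -/
theorem biproduct_desc_isotypicPieces_comp_component (a : ∀ l q, image (jf l ≫ (v ≫ biproduct.π Y q) ≫ i q) ⟶ Zf l)
    (ha : ∀ l q, a l q ≫ jf l = imageι (jf l ≫ (v ≫ biproduct.π Y q) ≫ i q))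
    (b : ∀ l q, image (jf l ≫ (v ≫ biproduct.π Y q) ≫ i q) ⟶ Y q)
    (hb : ∀ l q, b l q ≫ i q = imageι (jf l ≫ (v ≫ biproduct.π Y q) ≫ i q)) (q : Q) :
    biproduct.desc (fun l ↦ b l q) ≫ i q = biproduct.map (fun l ↦ a l q) ≫ biproduct.desc jf := by
  classical
  exact biproduct.hom_ext' _ _ fun l ↦ by
    rw [biproduct.ι_desc_assoc, hb, biproduct.ι_map_assoc, biproduct.ι_desc, ha]

/-- **`Σ_l Z_l = X ⟹ Σ_l (Z_l)_q = Y_q`**: surjectivity of the addition map of the `q`-th pieces of a family.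
[cite: MumfordAV1970, §19 Thm. 1 (p. 173) and Cor. 2 (p. 174)] [cite: LangeRodriguez2022, §2.9 Thm. 2.9.1 (PDF p. 43)] -/
theorem surjective_biproduct_desc_isotypicPieces_of_family (hi : ∀ q, IsClosedImmersion (Hom.toSchemeHom (i q)))
    (hdv : biproduct.desc i ≫ v = m • 𝟙 (⨁ Y)) (hm : m ≠ 0) [Surjective (Hom.toSchemeHom (biproduct.desc jf))]
    (b : ∀ l q, image (jf l ≫ (v ≫ biproduct.π Y q) ≫ i q) ⟶ Y q)
    (hb : ∀ l q, b l q ≫ i q = imageι (jf l ≫ (v ≫ biproduct.π Y q) ≫ i q)) (q : Q) :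
    Surjective (Hom.toSchemeHom (biproduct.desc fun l ↦ b l q)) := by
  haveI := hi q
  haveI : Surjective (Hom.toSchemeHom
      (biproduct.map (fun l ↦ toImage (jf l ≫ (v ≫ biproduct.π Y q) ≫ i q)) ≫ biproduct.desc (fun l ↦ b l q))) :=
    surjective_of_range_comp_eq _ (i q) (by
      rw [Category.assoc (biproduct.map _) (biproduct.desc fun l ↦ b l q) (i q),
        biproduct_map_toImage_comp_biproduct_desc_isotypicPieces_comp i jf b hb q,
        range_toSchemeHom_comp_eq_of_surjective (biproduct.desc jf) _, range_isotypicProjector i hdv hm q])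
  exact surjective_of_surjective_comp (biproduct.map fun l ↦ toImage (jf l ≫ (v ≫ biproduct.π Y q) ≫ i q)) _

/-- **ADDITIVITY FOR A FAMILY: `⨁_l Z_l → X` an isogeny ⟹ `⨁_l (Z_l)_q → Y_q` an isogeny** for every `q` (any field).
[cite: MumfordAV1970, §19 Thm. 1 and Cor. 1–2 (pp. 173–174)] [cite: Milne1986AbelianVarieties, §12 Prop. 12.1 and p. 122 (PDF p. 189)]
[cite: LangeRodriguez2022, §2.9 Thm. 2.9.1 (PDF p. 43)] -/
theorem isIsogeny_biproduct_desc_isotypicPieces_of_family (hi : ∀ q, IsClosedImmersion (Hom.toSchemeHom (i q)))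
    (hdv : biproduct.desc i ≫ v = m • 𝟙 (⨁ Y)) (hm : m ≠ 0) [∀ l, IsClosedImmersion (Hom.toSchemeHom (jf l))]
    (hJ : IsIsogeny (biproduct.desc jf)) (a : ∀ l q, image (jf l ≫ (v ≫ biproduct.π Y q) ≫ i q) ⟶ Zf l)
    (ha : ∀ l q, a l q ≫ jf l = imageι (jf l ≫ (v ≫ biproduct.π Y q) ≫ i q))
    (b : ∀ l q, image (jf l ≫ (v ≫ biproduct.π Y q) ≫ i q) ⟶ Y q)
    (hb : ∀ l q, b l q ≫ i q = imageι (jf l ≫ (v ≫ biproduct.π Y q) ≫ i q)) (q : Q) :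
    IsIsogeny (biproduct.desc fun l ↦ b l q) := by
  haveI := hJ.1
  refine ⟨surjective_biproduct_desc_isotypicPieces_of_family i jf hi hdv hm b hb q, ?_⟩
  haveI : ∀ l, IsClosedImmersion (Hom.toSchemeHom (a l q)) := fun l ↦
    isClosedImmersion_of_comp_eq_of_isClosedImmersion _ (jf l) (a l q) (ha l q)
  haveI := isFinite_toSchemeHom_biproduct_map fun l ↦ a l q
  haveI : IsFinite (Hom.toSchemeHom (biproduct.desc jf)) := hJ.2
  haveI : IsFinite (Hom.toSchemeHom (biproduct.map (fun l ↦ a l q) ≫ biproduct.desc jf)) :=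
    isFinite_toSchemeHom_comp _ _
  haveI : IsFinite (Hom.toSchemeHom (biproduct.desc (fun l ↦ b l q) ≫ i q)) := by
    rw [biproduct_desc_isotypicPieces_comp_component i jf a ha b hb q]
    infer_instance
  exact isFinite_of_isFinite_comp _ (i q)

/-- **`dim Y_q = Σ_l dim (Z_l)_q`** when `⨁_l Z_l → X` is an isogeny (any field).
[cite: MumfordAV1970, §19 Cor. 1 of Thm. 1 (p. 173)] [cite: Milne1986AbelianVarieties, §12 Prop. 12.1 and p. 122 (PDF p. 189)] -/
theorem dim_component_eq_sum_dim_isotypicPieces (hi : ∀ q, IsClosedImmersion (Hom.toSchemeHom (i q)))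
    (hdv : biproduct.desc i ≫ v = m • 𝟙 (⨁ Y)) (hm : m ≠ 0) [∀ l, IsClosedImmersion (Hom.toSchemeHom (jf l))]
    (hJ : IsIsogeny (biproduct.desc jf)) (a : ∀ l q, image (jf l ≫ (v ≫ biproduct.π Y q) ≫ i q) ⟶ Zf l)
    (ha : ∀ l q, a l q ≫ jf l = imageι (jf l ≫ (v ≫ biproduct.π Y q) ≫ i q))
    (b : ∀ l q, image (jf l ≫ (v ≫ biproduct.π Y q) ≫ i q) ⟶ Y q)
    (hb : ∀ l q, b l q ≫ i q = imageι (jf l ≫ (v ≫ biproduct.π Y q) ≫ i q)) (q : Q) :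
    (Y q).dim = ∑ l, (image (jf l ≫ (v ≫ biproduct.π Y q) ≫ i q)).dim := by
  rw [← dim_eq_of_isIsogeny (isIsogeny_biproduct_desc_isotypicPieces_of_family i jf hi hdv hm hJ a ha b hb q),
    dim_biproduct]

/-- **MULTIPLICITIES ADD OVER A FAMILY** (any field): `Y_q ∼ B^t`, `(Z_l)_q ∼ B^{s_l}`, `0 < dim B`, `⨁_l Z_l → X` an
isogeny ⟹ `t = Σ_l s_l`. [cite: MumfordAV1970, §19 Cor. 1 of Thm. 1 (p. 173)] [cite: Milne1986AbelianVarieties, §12 Prop. 12.1 and p. 122 (PDF p. 189)] -/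
theorem multiplicity_eq_sum_of_isIsogeny_biproduct_desc (hi : ∀ q, IsClosedImmersion (Hom.toSchemeHom (i q)))
    (hdv : biproduct.desc i ≫ v = m • 𝟙 (⨁ Y)) (hm : m ≠ 0) [∀ l, IsClosedImmersion (Hom.toSchemeHom (jf l))]
    (hJ : IsIsogeny (biproduct.desc jf)) (a : ∀ l q, image (jf l ≫ (v ≫ biproduct.π Y q) ≫ i q) ⟶ Zf l)
    (ha : ∀ l q, a l q ≫ jf l = imageι (jf l ≫ (v ≫ biproduct.π Y q) ≫ i q))
    (b : ∀ l q, image (jf l ≫ (v ≫ biproduct.π Y q) ≫ i q) ⟶ Y q)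
    (hb : ∀ l q, b l q ≫ i q = imageι (jf l ≫ (v ≫ biproduct.π Y q) ≫ i q)) (q : Q) {B : Motives.AbelianVariety K}
    (hB0 : 0 < B.dim) {t : ℕ} {s : L → ℕ} (ht : IsIsogenous (Y q) (⨁ fun _ : Fin t ↦ B))
    (hs : ∀ l, IsIsogenous (image (jf l ≫ (v ≫ biproduct.π Y q) ≫ i q)) (⨁ fun _ : Fin (s l) ↦ B)) : t = ∑ l, s l := by
  have hd := dim_component_eq_sum_dim_isotypicPieces i jf hi hdv hm hJ a ha b hb q
  rw [dim_eq_mul_of_isIsogenous_biproduct_const ht,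
    Finset.sum_congr rfl fun l _ ↦ dim_eq_mul_of_isIsogenous_biproduct_const (hs l), ← Finset.sum_mul] at hd
  exact Nat.eq_of_mul_eq_mul_right hB0 hd

end Family

/-! ## §3 Over a perfect field: pieces exist, complements exist -/

section Perfect

variable [PerfectField K] {Q : Type} [Fintype Q] {B : Q → Motives.AbelianVariety K} {n : Q → ℕ}
  {X Z Z' : Motives.AbelianVariety K} {Y : Q → Motives.AbelianVariety K}

/-- **`dim Y_q = dim u_q(Z) + dim u_q(Z')` for every `q` when `Z ⊞ Z' → X` is an isogeny** (perfect field; `Hom`-orthogonal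
system `i_q : Y_q ↪ X` with quasi-inverse `v`, `m ≠ 0`) — the pieces of `HodgeTheory/AbelianVarietySubvarietyIsotypicPieces`
exist by Poincaré reducibility. [cite: MumfordAV1970, §19 Thm. 1 and Cor. 1 (p. 173)] [cite: Milne1986AbelianVarieties, §12 Prop. 12.1 (PDF p. 189)] -/
theorem dim_component_eq_dim_isotypicPiece_add_of_perfectField (i : ∀ q, Y q ⟶ X)
    (hi : ∀ q, IsClosedImmersion (Hom.toSchemeHom (i q))) (hdesc : IsIsogeny (biproduct.desc i)) {v : X ⟶ ⨁ Y} {m : ℕ}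
    (hdv : biproduct.desc i ≫ v = m • 𝟙 (⨁ Y)) (horth : ∀ q q', q ≠ q' → ∀ g : Y q ⟶ Y q', g = 0) (hm : m ≠ 0)
    (j : Z ⟶ X) (j' : Z' ⟶ X) [IsClosedImmersion (Hom.toSchemeHom j)] [IsClosedImmersion (Hom.toSchemeHom j')]
    (hjj' : IsIsogeny (biprod.desc j j')) (q : Q) :
    (Y q).dim = (image (j ≫ (v ≫ biproduct.π Y q) ≫ i q)).dim + (image (j' ≫ (v ≫ biproduct.π Y q) ≫ i q)).dim := by
  obtain ⟨h, N, hN, hjh⟩ := exists_quasiRetraction_of_perfectField j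
  obtain ⟨h', N', hN', hj'h'⟩ := exists_quasiRetraction_of_perfectField j'
  obtain ⟨a, b, ha, -, hb, -⟩ := exists_isotypicPieces i j hi hdesc hdv horth hN hjh
  obtain ⟨a', b', ha', -, hb', -⟩ := exists_isotypicPieces i j' hi hdesc hdv horth hN' hj'h'
  exact dim_component_eq_dim_isotypicPiece_add i j j' hi hdv hm hjj' a ha a' ha' b hb b' hb' q

/-- `dim Y_q = Σ_l dim u_q(Z_l)` when `⨁_l Z_l → X` is an isogeny (perfect field).
[cite: MumfordAV1970, §19 Thm. 1 and Cor. 1 (p. 173)] [cite: Milne1986AbelianVarieties, §12 Prop. 12.1 (PDF p. 189)] -/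
theorem dim_component_eq_sum_dim_isotypicPieces_of_perfectField (i : ∀ q, Y q ⟶ X)
    (hi : ∀ q, IsClosedImmersion (Hom.toSchemeHom (i q))) (hdesc : IsIsogeny (biproduct.desc i)) {v : X ⟶ ⨁ Y} {m : ℕ}
    (hdv : biproduct.desc i ≫ v = m • 𝟙 (⨁ Y)) (horth : ∀ q q', q ≠ q' → ∀ g : Y q ⟶ Y q', g = 0) (hm : m ≠ 0)
    {L : Type} [Fintype L] {Zf : L → Motives.AbelianVariety K} (jf : ∀ l, Zf l ⟶ X)
    [∀ l, IsClosedImmersion (Hom.toSchemeHom (jf l))] (hJ : IsIsogeny (biproduct.desc jf)) (q : Q) :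
    (Y q).dim = ∑ l, (image (jf l ≫ (v ≫ biproduct.π Y q) ≫ i q)).dim := by
  have hq : ∀ l, ∃ (h : X ⟶ Zf l) (N : ℕ), N ≠ 0 ∧ jf l ≫ h = N • 𝟙 (Zf l) := fun l ↦
    exists_quasiRetraction_of_perfectField (jf l)
  choose h N hN hjh using hq
  have hp : ∀ l, ∃ (a : ∀ q, image (jf l ≫ (v ≫ biproduct.π Y q) ≫ i q) ⟶ Zf l)
      (b : ∀ q, image (jf l ≫ (v ≫ biproduct.π Y q) ≫ i q) ⟶ Y q),
      (∀ q, a q ≫ jf l = imageι (jf l ≫ (v ≫ biproduct.π Y q) ≫ i q)) ∧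
        ∀ q, b q ≫ i q = imageι (jf l ≫ (v ≫ biproduct.π Y q) ≫ i q) := fun l ↦ by
    obtain ⟨a, b, ha, -, hb, -⟩ := exists_isotypicPieces i (jf l) hi hdesc hdv horth (hN l) (hjh l)
    exact ⟨a, b, ha, hb⟩
  choose a b ha hb using hp
  exact dim_component_eq_sum_dim_isotypicPieces i jf hi hdv hm hJ a ha b hb q

/-- **THE MULTIPLICITIES OF THE ISOTYPIC COMPONENTS ADD ALONG `Z ⊞ Z' → X`** (perfect field): for isotypic components
`Y_q ∼ B_q^{n_q+1}` of `X` (`B_q` simple of positive dimension, pairwise non-isogenous, addition map an isogeny) with a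
quasi-inverse `v` (`m ≠ 0`), abelian subvarieties `Z`, `Z'` with `Z ⊞ Z' → X` an isogeny and `u_q(Z) ∼ B_q^{s}`,
`u_q(Z') ∼ B_q^{s'}`: `n_q + 1 = s + s'`. [cite: MumfordAV1970, §19 Cor. 1 of Thm. 1 (p. 173)]
[cite: Milne1986AbelianVarieties, §12 Prop. 12.1 and p. 122 (PDF p. 189: «the r_i are uniquely determined»)] -/
theorem multiplicity_isotypicComponents_eq_add (hB : ∀ q, (B q).IsSimple) (hB0 : ∀ q, 0 < (B q).dim)
    (hni : ∀ q q', q ≠ q' → ¬ IsIsogenous (B q) (B q')) (hY : ∀ q, IsIsogenous (Y q) (⨁ fun _ : Fin (n q + 1) ↦ B q))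
    (i : ∀ q, Y q ⟶ X) (hi : ∀ q, IsClosedImmersion (Hom.toSchemeHom (i q))) (hdesc : IsIsogeny (biproduct.desc i))
    {v : X ⟶ ⨁ Y} {m : ℕ} (hdv : biproduct.desc i ≫ v = m • 𝟙 (⨁ Y)) (hm : m ≠ 0) (j : Z ⟶ X) (j' : Z' ⟶ X)
    [IsClosedImmersion (Hom.toSchemeHom j)] [IsClosedImmersion (Hom.toSchemeHom j')] (hjj' : IsIsogeny (biprod.desc j j'))
    (q : Q) {s s' : ℕ} (hs : IsIsogenous (image (j ≫ (v ≫ biproduct.π Y q) ≫ i q)) (⨁ fun _ : Fin s ↦ B q))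
    (hs' : IsIsogenous (image (j' ≫ (v ≫ biproduct.π Y q) ≫ i q)) (⨁ fun _ : Fin s' ↦ B q)) : n q + 1 = s + s' := by
  have horth : ∀ q q', q ≠ q' → ∀ g : Y q ⟶ Y q', g = 0 := fun q q' hqq' g ↦
    hom_eq_zero_of_isIsogenous_biproduct_const_of_ne hB hB0 hni hqq' (hY q) (hY q') g
  have hd := dim_component_eq_dim_isotypicPiece_add_of_perfectField i hi hdesc hdv horth hm j j' hjj' q
  rw [dim_eq_mul_of_isIsogenous_biproduct_const (hY q), dim_eq_mul_of_isIsogenous_biproduct_const hs,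
    dim_eq_mul_of_isIsogenous_biproduct_const hs', ← add_mul] at hd
  exact Nat.eq_of_mul_eq_mul_right (hB0 q) hd

/-- **Every abelian subvariety has a Poincaré complement, and the pieces of the two add up to the components** (perfect
field): for `j : Z ↪ X` there are `j' : Z' ↪ X` with `Z ⊞ Z' → X` an isogeny and `dim Y_q = dim u_q(Z) + dim u_q(Z')`
for all `q`. [cite: MumfordAV1970, §19 Thm. 1 (p. 173)] [cite: Milne1986AbelianVarieties, §12 Prop. 12.1 (PDF p. 189)] -/
theorem exists_complement_dim_component_eq_add (i : ∀ q, Y q ⟶ X) (hi : ∀ q, IsClosedImmersion (Hom.toSchemeHom (i q)))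
    (hdesc : IsIsogeny (biproduct.desc i)) {v : X ⟶ ⨁ Y} {m : ℕ} (hdv : biproduct.desc i ≫ v = m • 𝟙 (⨁ Y))
    (horth : ∀ q q', q ≠ q' → ∀ g : Y q ⟶ Y q', g = 0) (hm : m ≠ 0) (j : Z ⟶ X) [IsClosedImmersion (Hom.toSchemeHom j)] :
    ∃ (Z' : Motives.AbelianVariety K) (j' : Z' ⟶ X), IsClosedImmersion (Hom.toSchemeHom j') ∧
      IsIsogeny (biprod.desc j j') ∧ ∀ q, (Y q).dim =
        (image (j ≫ (v ≫ biproduct.π Y q) ≫ i q)).dim + (image (j' ≫ (v ≫ biproduct.π Y q) ≫ i q)).dim := by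
  obtain ⟨Z', j', hj', hjj'⟩ := poincare_complete_reducibility_of_perfectField j
  haveI := hj'
  exact ⟨Z', j', hj', hjj', fun q ↦ dim_component_eq_dim_isotypicPiece_add_of_perfectField i hi hdesc hdv horth hm j j' hjj' q⟩

end Perfect

end AbelianVariety

end Literature.AlgebraicGeometry.HodgeTheory

end
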